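import Summits.HodgeConjecture.HodgeConjecture.Theorems.F0P3cStCharTSHCDCoordinates   -- ★ (CO) FILE 1 (this seat): §0 left inverse, §1 `lie_eq_iff` + pair∕skew algebra, §2 `exists_coords_lie`
import HarnessLib

/-!
# F0 · P3c · line LH6 «StCharTS» — ROAD «HC-D» brick (CO) «REAL-FORM COORDINATES», FILE 1 (sequel): the trace-zero chart
# `Φ₀ : (Fin 8 → F′) ≃ₜ+ ↥𝔲₀` and the transport of Haar measure along the charts

Cell `pub/hodgecm-mathlib`, crux H413 = `stmt-HodgeConjecture-24833` (lane `--supports … --as helper`), route HCCMUnconditional; seat F0P2-p06 (g18), brick (CO) of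
the road «HC-D» of F0P2-p01 (g23) (deal: bus F0∕P2 2026-09-02T16:29:10Z «R3♭ (3)»).  THEOREMS ONLY (no definition ∕ instance ∕ notation ∕ named fact ∕ `sorry`);
Mathlib + ★ FILE 1 `…HCDCoordinates` (split off for the 400-line rule; same frame and letters — see its docstring for the SETTING and the INDEX BOOKKEEPING).

* §3 **`exists_coords_lie_traceZero`** — an explicit `Φ₀ : (Fin 8 → F′) ≃ₜ+ ↥𝔲₀` for an ARBITRARY additive subgroup `𝔲₀` with
  `h𝔲₀ : X ∈ 𝔲₀ ↔ (X.map σ)ᵀ * J + J * X = 0 ∧ trace X = 0`, `J = !![0,0,1;0,1,0;1,0,0]`: entries `X₀₀ = ι a₀ + lam·ι a₁`, `X₀₁ = ι a₂ + lam·ι a₃`,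
  `X₁₀ = ι a₄ + lam·ι a₅`, `X₀₂ = lam·ι a₆`, `X₁₁ = −2·lam·ι a₁` (trace zero), `X₂₀ = lam·ι a₇`, `X₂₂ = −ι a₀ + lam·ι a₁`, `X₁₂ = −ι a₂ + lam·ι a₃`,
  `X₂₁ = −ι a₄ + lam·ι a₅`; scaling equivariance `Φ₀ (l • a) = ι l • Φ₀ a` (as matrices).
* §4 HAAR: `isAddHaarMeasure_map_coords` — the image of ANY additive Haar measure on `Fin n → F′` under a chart `≃ₜ+ ↥𝔲₀` is additive Haar (Mathlib instance
  `ContinuousAddEquiv.isAddHaarMeasure_map`, explicit for docking; applies to `Measure.pi`); `exists_map_coords_eq_smul` — `ν.map Φ₀ = c • μ` with `0 < c` for Haar `μ`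
  on `↥𝔲₀` when `F′` is locally compact second countable (Haar uniqueness, local compactness ∕ second countability transported along `Φ₀`).
Consumers: D3v «VERTEX ENGINE» (LH10-p01), D5(iv)+GLOBAL (F0P3a-p07), D3b∕c docking (F0P3b-p01), D5(i)∕(iii).
HONEST LABEL: HC_CM is proved only modulo the 7 printed citations (2 remaining named inputs: hLiu418 = `stmt-HodgeConjecture-24832`, h413 = `stmt-HodgeConjecture-24833`)
until rung 0 closes; this file closes no organ (count-neutral plumbing for the (HC-D) named input `hDGliO` of ★ RUNG0).

## References
* [Rogawski1990] J. D. Rogawski, *Automorphic Representations of Unitary Groups in Three Variables*, Ann. of Math. Stud. 123 (1990), §4.9 p. 54, §12.5 p. 182.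
* [PlatonovRapinchuk1994] V. Platonov, A. Rapinchuk, *Algebraic Groups and Number Theory* (1994), §2.3.3, §3.3 (unitary groups over quadratic extensions; Haar measure).
* [HarishChandra1970] Harish-Chandra, *Harmonic analysis on reductive p-adic groups*, LNM 162 (1970), Part VII §1 Thm. 15.
-/

set_option autoImplicit false
-- the mandated namespace has the single-problem summit's repeated segment (`HodgeConjecture.HodgeConjecture`)
set_option linter.dupNamespace false

open Matrix Topology MeasureTheory
open scoped ENNReal

namespace Summit.HodgeConjecture.HodgeConjecture.Cruxes.H413.F0P3cStCharTSHCDCoordinates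

section Charts

variable {K : Type*} [Field K] [TopologicalSpace K] [IsTopologicalRing K]
  (σ : K →+* K) (hσ : ∀ x, σ (σ x) = x) [Invertible (2 : K)]
  {J : Matrix (Fin 3) (Fin 3) K} (hJ : J = !![0, 0, 1; 0, 1, 0; 1, 0, 0])
  {F' : Type*} [Field F'] [TopologicalSpace F']
  (ι : F' →+* K) (hι : IsClosedEmbedding ι) (hιr : ∀ x, σ x = x ↔ x ∈ Set.range ι)
  (lam : Kˣ) (hlam : σ lam = -lam)

include hσ hJ hι hιr hlam

/-! ## §3 The chart `Φ₀ : (Fin 8 → F′) ≃ₜ+ ↥𝔲₀` of the trace-zero part -/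

/-- **The coordinate chart of the trace-zero part `𝔲₀`**: an explicit `Φ₀ : (Fin 8 → F′) ≃ₜ+ ↥𝔲₀` with entries
`X₀₀ = ι a₀ + lam·ι a₁`, `X₀₁ = ι a₂ + lam·ι a₃`, `X₁₀ = ι a₄ + lam·ι a₅`, `X₀₂ = lam·ι a₆`, `X₁₁ = −2·lam·ι a₁` (trace zero), `X₂₀ = lam·ι a₇`,
`X₂₂ = −ι a₀ + lam·ι a₁`, `X₁₂ = −ι a₂ + lam·ι a₃`, `X₂₁ = −ι a₄ + lam·ι a₅`, and the scaling equivariance `Φ₀ (l • a) = ι l • Φ₀ a` (as matrices).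
[cite: Rogawski1990, §4.9 p. 54] [cite: PlatonovRapinchuk1994, §2.3.3] -/
theorem exists_coords_lie_traceZero (𝔲₀ : AddSubgroup (Matrix (Fin 3) (Fin 3) K))
    (h𝔲₀ : ∀ X, X ∈ 𝔲₀ ↔ (X.map σ)ᵀ * J + J * X = 0 ∧ Matrix.trace X = 0) :
    ∃ Φ₀ : (Fin 8 → F') ≃ₜ+ ↥𝔲₀,
      (∀ a : Fin 8 → F',
        ((Φ₀ a : ↥𝔲₀) : Matrix (Fin 3) (Fin 3) K) 0 0 = ι (a 0) + lam * ι (a 1) ∧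
        ((Φ₀ a : ↥𝔲₀) : Matrix (Fin 3) (Fin 3) K) 0 1 = ι (a 2) + lam * ι (a 3) ∧
        ((Φ₀ a : ↥𝔲₀) : Matrix (Fin 3) (Fin 3) K) 1 0 = ι (a 4) + lam * ι (a 5) ∧
        ((Φ₀ a : ↥𝔲₀) : Matrix (Fin 3) (Fin 3) K) 0 2 = lam * ι (a 6) ∧
        ((Φ₀ a : ↥𝔲₀) : Matrix (Fin 3) (Fin 3) K) 1 1 = -(2 * (lam * ι (a 1))) ∧
        ((Φ₀ a : ↥𝔲₀) : Matrix (Fin 3) (Fin 3) K) 2 0 = lam * ι (a 7) ∧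
        ((Φ₀ a : ↥𝔲₀) : Matrix (Fin 3) (Fin 3) K) 2 2 = -ι (a 0) + lam * ι (a 1) ∧
        ((Φ₀ a : ↥𝔲₀) : Matrix (Fin 3) (Fin 3) K) 1 2 = -ι (a 2) + lam * ι (a 3) ∧
        ((Φ₀ a : ↥𝔲₀) : Matrix (Fin 3) (Fin 3) K) 2 1 = -ι (a 4) + lam * ι (a 5)) ∧
      (∀ (l : F') (a : Fin 8 → F'), ((Φ₀ (l • a) : ↥𝔲₀) : Matrix (Fin 3) (Fin 3) K) = ι l • ((Φ₀ a : ↥𝔲₀) : Matrix (Fin 3) (Fin 3) K)) := by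
  subst hJ
  obtain ⟨g, hg, hgc⟩ := exists_continuousOn_leftInverse ι hι
  have hισ : ∀ a, σ (ι a) = ι a := fun a => (hιr _).2 ⟨a, rfl⟩
  have hfix : ∀ x : K, σ x = x → ι (g x) = x := fun x hx => by
    obtain ⟨a, rfl⟩ := (hιr x).1 hx; rw [hg]
  have hιc : Continuous ι := hι.continuous
  have h22 : (2 : K) * ⅟(2 : K) = 1 := mul_invOf_self 2
  -- the forward matrix
  set M : (Fin 8 → F') → Matrix (Fin 3) (Fin 3) K := fun a =>
    !![ι (a 0) + lam * ι (a 1), ι (a 2) + lam * ι (a 3), lam * ι (a 6);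
       ι (a 4) + lam * ι (a 5), -(2 * (lam * ι (a 1))), -ι (a 2) + lam * ι (a 3);
       lam * ι (a 7), -ι (a 4) + lam * ι (a 5), -ι (a 0) + lam * ι (a 1)] with hM
  have hMmem : ∀ a, M a ∈ 𝔲₀ := fun a => by
    rw [h𝔲₀, lie_eq_iff, Matrix.trace_fin_three]
    simp only [hM, Matrix.of_apply, Matrix.cons_val', Matrix.cons_val_zero, Matrix.cons_val_one, Matrix.cons_val_two, Matrix.head_cons,
      Matrix.tail_cons, Matrix.empty_val', Matrix.cons_val_fin_one, Matrix.head_fin_const, map_add, map_neg, map_mul, map_ofNat, hισ, hlam]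
    refine ⟨⟨⟨by ring, by ring, by ring⟩, ⟨by ring, by ring, by ring⟩, ⟨by ring, by ring, by ring⟩⟩, by ring⟩
  -- the backward coordinates
  set N : Matrix (Fin 3) (Fin 3) K → (Fin 8 → F') := fun X =>
    ![g ((X 0 0 - X 2 2) * ⅟(2 : K)), g ((X 0 0 + X 2 2) * ⅟(2 : K) * ((lam⁻¹ : Kˣ) : K)),
      g ((X 0 1 - X 1 2) * ⅟(2 : K)), g ((X 0 1 + X 1 2) * ⅟(2 : K) * ((lam⁻¹ : Kˣ) : K)),
      g ((X 1 0 - X 2 1) * ⅟(2 : K)), g ((X 1 0 + X 2 1) * ⅟(2 : K) * ((lam⁻¹ : Kˣ) : K)),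
      g (X 0 2 * ((lam⁻¹ : Kˣ) : K)), g (X 2 0 * ((lam⁻¹ : Kˣ) : K))] with hN
  -- left inverse
  have hNM : ∀ a, N (M a) = a := fun a => by
    funext k
    fin_cases k <;>
      simp only [hN, hM, Matrix.of_apply, Matrix.cons_val', Matrix.cons_val_zero, Matrix.cons_val_one, Matrix.cons_val_two, Matrix.head_cons,
        Matrix.tail_cons, Matrix.empty_val', Matrix.cons_val_fin_one, Matrix.head_fin_const, Fin.isValue, Fin.mk_zero, Fin.mk_one, Fin.reduceFinMk,
        Matrix.cons_val, pair_fst, pair_snd, skew_coord, hg]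
  -- right inverse on `𝔲₀`
  have hMN : ∀ X ∈ 𝔲₀, M (N X) = X := fun X hX => by
    rw [h𝔲₀, lie_eq_iff, Matrix.trace_fin_three] at hX
    obtain ⟨⟨⟨h00, h01, h02⟩, ⟨h10, h11, h12⟩, ⟨h20, h21, h22'⟩⟩, htr⟩ := hX
    have f0 := hfix _ (pair_fst_fixed σ hσ h02)
    have f1 := hfix _ (pair_snd_fixed σ hσ lam hlam h02)
    have f2 := hfix _ (pair_fst_fixed σ hσ h12)
    have f3 := hfix _ (pair_snd_fixed σ hσ lam hlam h12)
    have f4 := hfix _ (pair_fst_fixed σ hσ h01)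
    have f5 := hfix _ (pair_snd_fixed σ hσ lam hlam h01)
    have f6 := hfix _ (skew_fixed σ lam hlam h22')
    have f7 := hfix _ (skew_fixed σ lam hlam h00)
    ext i j
    fin_cases i <;> fin_cases j <;>
      simp only [hM, hN, Matrix.of_apply, Matrix.cons_val', Matrix.cons_val_zero, Matrix.cons_val_one, Matrix.cons_val_two, Matrix.head_cons,
        Matrix.tail_cons, Matrix.empty_val', Matrix.cons_val_fin_one, Matrix.head_fin_const, Fin.isValue, Fin.mk_zero, Fin.mk_one, Fin.reduceFinMk,
        Matrix.cons_val, f0, f1, f2, f3, f4, f5, f6, f7] <;>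
      first
        | exact pair_recombine_fst lam _ _
        | exact pair_recombine_snd lam _ _
        | exact skew_recombine lam _
        | (rw [skew_recombine]; linear_combination (-(X 0 0 + X 2 2)) * h22 + (-1 : K) * htr)
  -- continuity
  have hMc : Continuous M := by
    refine continuous_matrix fun i j => ?_
    fin_cases i <;> fin_cases j <;>
      simp only [hM, Matrix.of_apply, Matrix.cons_val', Matrix.cons_val_zero, Matrix.cons_val_one, Matrix.cons_val_two, Matrix.head_cons,
        Matrix.tail_cons, Matrix.empty_val', Matrix.cons_val_fin_one, Matrix.head_fin_const, Fin.isValue, Fin.mk_zero, Fin.mk_one, Fin.reduceFinMk] <;>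
      fun_prop
  have hNc : Continuous fun X : ↥𝔲₀ => N (X : Matrix (Fin 3) (Fin 3) K) := by
    refine continuous_pi fun k => ?_
    have hent : ∀ i j, Continuous fun X : ↥𝔲₀ => (X : Matrix (Fin 3) (Fin 3) K) i j :=
      fun i j => (continuous_apply j).comp ((continuous_apply i).comp continuous_subtype_val)
    have hmem : ∀ X : ↥𝔲₀, (((X : Matrix (Fin 3) (Fin 3) K).map σ)ᵀ * !![(0 : K), 0, 1; 0, 1, 0; 1, 0, 0] +
        !![(0 : K), 0, 1; 0, 1, 0; 1, 0, 0] * (X : Matrix (Fin 3) (Fin 3) K) = 0) := fun X => ((h𝔲₀ _).1 X.2).1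
    fin_cases k <;>
      simp only [hN, Matrix.cons_val_zero, Matrix.cons_val_one, Matrix.cons_val_two, Matrix.head_cons, Matrix.tail_cons,
        Fin.isValue, Fin.mk_zero, Fin.mk_one, Fin.reduceFinMk, Matrix.cons_val]
    · exact hgc.comp_continuous ((hent 0 0).sub (hent 2 2) |>.mul continuous_const) fun X =>
        (hιr _).1 (pair_fst_fixed σ hσ ((lie_eq_iff σ _).1 (hmem X)).1.2.2)
    · exact hgc.comp_continuous (((hent 0 0).add (hent 2 2) |>.mul continuous_const).mul continuous_const) fun X =>
        (hιr _).1 (pair_snd_fixed σ hσ lam hlam ((lie_eq_iff σ _).1 (hmem X)).1.2.2)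
    · exact hgc.comp_continuous ((hent 0 1).sub (hent 1 2) |>.mul continuous_const) fun X =>
        (hιr _).1 (pair_fst_fixed σ hσ ((lie_eq_iff σ _).1 (hmem X)).2.1.2.2)
    · exact hgc.comp_continuous (((hent 0 1).add (hent 1 2) |>.mul continuous_const).mul continuous_const) fun X =>
        (hιr _).1 (pair_snd_fixed σ hσ lam hlam ((lie_eq_iff σ _).1 (hmem X)).2.1.2.2)
    · exact hgc.comp_continuous ((hent 1 0).sub (hent 2 1) |>.mul continuous_const) fun X =>
        (hιr _).1 (pair_fst_fixed σ hσ ((lie_eq_iff σ _).1 (hmem X)).1.2.1)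
    · exact hgc.comp_continuous (((hent 1 0).add (hent 2 1) |>.mul continuous_const).mul continuous_const) fun X =>
        (hιr _).1 (pair_snd_fixed σ hσ lam hlam ((lie_eq_iff σ _).1 (hmem X)).1.2.1)
    · exact hgc.comp_continuous ((hent 0 2).mul continuous_const) fun X =>
        (hιr _).1 (skew_fixed σ lam hlam ((lie_eq_iff σ _).1 (hmem X)).2.2.2.2)
    · exact hgc.comp_continuous ((hent 2 0).mul continuous_const) fun X =>
        (hιr _).1 (skew_fixed σ lam hlam ((lie_eq_iff σ _).1 (hmem X)).1.1)
  -- additivity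
  have hMadd : ∀ a b, M (a + b) = M a + M b := fun a b => by
    ext i j
    fin_cases i <;> fin_cases j <;>
      simp only [hM, Matrix.add_apply, Pi.add_apply, Matrix.of_apply, Matrix.cons_val', Matrix.cons_val_zero, Matrix.cons_val_one, Matrix.cons_val_two,
        Matrix.head_cons, Matrix.tail_cons, Matrix.empty_val', Matrix.cons_val_fin_one, Matrix.head_fin_const, Fin.isValue, Fin.mk_zero, Fin.mk_one,
        Fin.reduceFinMk, map_add] <;> ring
  -- assemble
  let Φ₀ : (Fin 8 → F') ≃ₜ+ ↥𝔲₀ :=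
    { toFun := fun a => ⟨M a, hMmem a⟩
      invFun := fun X => N (X : Matrix (Fin 3) (Fin 3) K)
      left_inv := fun a => hNM a
      right_inv := fun X => Subtype.ext (hMN X.1 X.2)
      map_add' := fun a b => Subtype.ext (hMadd a b)
      continuous_toFun := hMc.subtype_mk _
      continuous_invFun := hNc }
  have hΦ : ∀ a, ((Φ₀ a : ↥𝔲₀) : Matrix (Fin 3) (Fin 3) K) = M a := fun a => rfl
  refine ⟨Φ₀, fun a => ?_, fun l a => ?_⟩
  · simp only [hΦ, hM, Matrix.of_apply, Matrix.cons_val', Matrix.cons_val_zero, Matrix.cons_val_one, Matrix.cons_val_two, Matrix.head_cons,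
      Matrix.tail_cons, Matrix.empty_val', Matrix.cons_val_fin_one, Matrix.head_fin_const, and_self]
  · rw [hΦ, hΦ]
    ext i j
    fin_cases i <;> fin_cases j <;>
      simp only [hM, Matrix.smul_apply, Pi.smul_apply, smul_eq_mul, Matrix.of_apply, Matrix.cons_val', Matrix.cons_val_zero, Matrix.cons_val_one,
        Matrix.cons_val_two, Matrix.head_cons, Matrix.tail_cons, Matrix.empty_val', Matrix.cons_val_fin_one, Matrix.head_fin_const, Fin.isValue,
        Fin.mk_zero, Fin.mk_one, Fin.reduceFinMk, map_mul] <;> ring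

/-! ## §3b The centre splitting `Φ_𝔷 : ↥𝔲 ≃ₜ+ F′ × ↥𝔲₀` (`X = z·1 + Y`, `z = tr X ∕ 3` a skew scalar) -/

omit hσ [Invertible (2 : K)] in
/-- **Centre–Fubini chart**: for `3 ∈ Kˣ`, an explicit `Φ_𝔷 : ↥𝔲 ≃ₜ+ F′ × ↥𝔲₀` splitting `X = (lam·ι b)·1 + Y` with `Y` trace-free: the inverse letter
`Φ_𝔷.symm (b, Y) = (lam·ι b) • 1 + Y`, and the forward letters `lam·ι (Φ_𝔷 X).1 = ⅟3 · trace X`, `(Φ_𝔷 X).2 = X − (lam·ι (Φ_𝔷 X).1) • 1` (as matrices);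
the trace of an element of `𝔲` is skew, so `z = tr X ∕ 3 = lam·ι b`. [cite: Rogawski1990, §4.9 p. 54] [cite: PlatonovRapinchuk1994, §2.3.3] -/
theorem exists_coords_centre [Invertible (3 : K)] (𝔲 𝔲₀ : AddSubgroup (Matrix (Fin 3) (Fin 3) K))
    (h𝔲 : ∀ X, X ∈ 𝔲 ↔ (X.map σ)ᵀ * J + J * X = 0) (h𝔲₀ : ∀ X, X ∈ 𝔲₀ ↔ (X.map σ)ᵀ * J + J * X = 0 ∧ Matrix.trace X = 0) :
    ∃ Φz : ↥𝔲 ≃ₜ+ F' × ↥𝔲₀,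
      (∀ (b : F') (Y : ↥𝔲₀), ((Φz.symm (b, Y) : ↥𝔲) : Matrix (Fin 3) (Fin 3) K) = (lam * ι b) • (1 : Matrix (Fin 3) (Fin 3) K) + (Y : Matrix (Fin 3) (Fin 3) K)) ∧
      (∀ X : ↥𝔲, lam * ι (Φz X).1 = ⅟(3 : K) * Matrix.trace (X : Matrix (Fin 3) (Fin 3) K) ∧
        (((Φz X).2 : ↥𝔲₀) : Matrix (Fin 3) (Fin 3) K) = (X : Matrix (Fin 3) (Fin 3) K) - (lam * ι (Φz X).1) • (1 : Matrix (Fin 3) (Fin 3) K)) := by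
  subst hJ
  obtain ⟨g, hg, hgc⟩ := exists_continuousOn_leftInverse ι hι
  have hισ : ∀ a, σ (ι a) = ι a := fun a => (hιr _).2 ⟨a, rfl⟩
  have hfix : ∀ x : K, σ x = x → ι (g x) = x := fun x hx => by
    obtain ⟨a, rfl⟩ := (hιr x).1 hx; rw [hg]
  have hιc : Continuous ι := hι.continuous
  have h33 : (3 : K) * ⅟(3 : K) = 1 := mul_invOf_self 3
  have hσ3 : σ (⅟(3 : K)) = ⅟(3 : K) := by
    have h : σ (⅟(3 : K)) * 3 = 1 := by
      have := congrArg σ (invOf_mul_self (3 : K))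
      rwa [map_mul, map_ofNat, map_one] at this
    calc σ (⅟(3 : K)) = σ (⅟(3 : K)) * 3 * ⅟(3 : K) := by rw [mul_invOf_cancel_right]
      _ = ⅟(3 : K) := by rw [h, one_mul]
  -- a skew scalar matrix lies in `𝔲`
  have hcentral : ∀ z : K, σ z + z = 0 → ((z • (1 : Matrix (Fin 3) (Fin 3) K)).map σ)ᵀ * !![(0 : K), 0, 1; 0, 1, 0; 1, 0, 0] + !![(0 : K), 0, 1; 0, 1, 0; 1, 0, 0] * (z • (1 : Matrix (Fin 3) (Fin 3) K)) = 0 := by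
    intro z hz
    have hmap : (z • (1 : Matrix (Fin 3) (Fin 3) K)).map σ = σ z • (1 : Matrix (Fin 3) (Fin 3) K) := by
      ext i j
      simp only [Matrix.map_apply, Matrix.smul_apply, smul_eq_mul, map_mul]
      by_cases h : i = j
      · subst h; simp
      · simp [Matrix.one_apply_ne h]
    rw [hmap, Matrix.transpose_smul, Matrix.transpose_one, Matrix.smul_mul, Matrix.one_mul, Matrix.mul_smul, Matrix.mul_one, ← add_smul, hz,
      zero_smul]
  -- the trace of an element of `𝔲` is skew
  have htrace_skew : ∀ X : Matrix (Fin 3) (Fin 3) K, (X.map σ)ᵀ * !![(0 : K), 0, 1; 0, 1, 0; 1, 0, 0] + !![(0 : K), 0, 1; 0, 1, 0; 1, 0, 0] * X = 0 →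
      σ (Matrix.trace X) + Matrix.trace X = 0 := by
    intro X hX
    rw [lie_eq_iff] at hX
    obtain ⟨⟨-, -, h02⟩, ⟨-, h11, -⟩, ⟨h20, -, -⟩⟩ := hX
    rw [Matrix.trace_fin_three, map_add, map_add]
    linear_combination h02 + h11 + h20
  -- the coordinate of the centre: `z = ⅟3 · tr X = lam · ι b`
  have hzfix : ∀ X : Matrix (Fin 3) (Fin 3) K, (X.map σ)ᵀ * !![(0 : K), 0, 1; 0, 1, 0; 1, 0, 0] + !![(0 : K), 0, 1; 0, 1, 0; 1, 0, 0] * X = 0 →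
      ι (g (⅟(3 : K) * Matrix.trace X * ((lam⁻¹ : Kˣ) : K))) = ⅟(3 : K) * Matrix.trace X * ((lam⁻¹ : Kˣ) : K) := by
    intro X hX
    refine hfix _ ?_
    have hsk : σ (⅟(3 : K) * Matrix.trace X) + ⅟(3 : K) * Matrix.trace X = 0 := by
      rw [map_mul, hσ3]; linear_combination (⅟(3 : K)) * htrace_skew X hX
    exact skew_fixed σ lam hlam hsk
  -- forward and backward maps
  have hfwd_mem : ∀ X : ↥𝔲, (X : Matrix (Fin 3) (Fin 3) K) - (⅟(3 : K) * Matrix.trace (X : Matrix (Fin 3) (Fin 3) K)) • (1 : Matrix (Fin 3) (Fin 3) K) ∈ 𝔲₀ := by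
    intro X
    have hX := (h𝔲 _).1 X.2
    rw [h𝔲₀]
    refine ⟨?_, ?_⟩
    · have hz := hcentral (⅟(3 : K) * Matrix.trace (X : Matrix (Fin 3) (Fin 3) K)) (by rw [map_mul, hσ3]; linear_combination (⅟(3 : K)) * htrace_skew _ hX)
      have e : (((X : Matrix (Fin 3) (Fin 3) K) - (⅟(3 : K) * Matrix.trace (X : Matrix (Fin 3) (Fin 3) K)) • (1 : Matrix (Fin 3) (Fin 3) K)).map σ)ᵀ * !![(0 : K), 0, 1; 0, 1, 0; 1, 0, 0] +
          !![(0 : K), 0, 1; 0, 1, 0; 1, 0, 0] * ((X : Matrix (Fin 3) (Fin 3) K) - (⅟(3 : K) * Matrix.trace (X : Matrix (Fin 3) (Fin 3) K)) • (1 : Matrix (Fin 3) (Fin 3) K)) =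
          (((X : Matrix (Fin 3) (Fin 3) K).map σ)ᵀ * !![(0 : K), 0, 1; 0, 1, 0; 1, 0, 0] + !![(0 : K), 0, 1; 0, 1, 0; 1, 0, 0] * (X : Matrix (Fin 3) (Fin 3) K)) -
          ((((⅟(3 : K) * Matrix.trace (X : Matrix (Fin 3) (Fin 3) K)) • (1 : Matrix (Fin 3) (Fin 3) K)).map σ)ᵀ * !![(0 : K), 0, 1; 0, 1, 0; 1, 0, 0] +
            !![(0 : K), 0, 1; 0, 1, 0; 1, 0, 0] * ((⅟(3 : K) * Matrix.trace (X : Matrix (Fin 3) (Fin 3) K)) • (1 : Matrix (Fin 3) (Fin 3) K))) := by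
        rw [Matrix.map_sub _ (map_sub σ), Matrix.transpose_sub, Matrix.sub_mul, Matrix.mul_sub]; abel
      rw [e, hX, hz, sub_zero]
    · rw [Matrix.trace_sub, Matrix.trace_smul, Matrix.trace_one, smul_eq_mul]
      simp only [Fintype.card_fin, Nat.cast_ofNat]
      linear_combination (-(Matrix.trace (X : Matrix (Fin 3) (Fin 3) K))) * h33 + Matrix.trace (X : Matrix (Fin 3) (Fin 3) K) * (mul_comm (⅟(3:K)) 3)
  have hbwd_mem : ∀ (b : F') (Y : ↥𝔲₀), (lam * ι b) • (1 : Matrix (Fin 3) (Fin 3) K) + (Y : Matrix (Fin 3) (Fin 3) K) ∈ 𝔲 := by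
    intro b Y
    have hY := ((h𝔲₀ _).1 Y.2).1
    have hz := hcentral (lam * ι b) (by rw [map_mul, hlam, hισ]; ring)
    rw [h𝔲]
    have e : ((((lam : K) * ι b) • (1 : Matrix (Fin 3) (Fin 3) K) + (Y : Matrix (Fin 3) (Fin 3) K)).map σ)ᵀ * !![(0 : K), 0, 1; 0, 1, 0; 1, 0, 0] +
        !![(0 : K), 0, 1; 0, 1, 0; 1, 0, 0] * (((lam : K) * ι b) • (1 : Matrix (Fin 3) (Fin 3) K) + (Y : Matrix (Fin 3) (Fin 3) K)) =
        (((((lam : K) * ι b) • (1 : Matrix (Fin 3) (Fin 3) K)).map σ)ᵀ * !![(0 : K), 0, 1; 0, 1, 0; 1, 0, 0] + !![(0 : K), 0, 1; 0, 1, 0; 1, 0, 0] * (((lam : K) * ι b) • (1 : Matrix (Fin 3) (Fin 3) K))) +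
        ((((Y : Matrix (Fin 3) (Fin 3) K)).map σ)ᵀ * !![(0 : K), 0, 1; 0, 1, 0; 1, 0, 0] + !![(0 : K), 0, 1; 0, 1, 0; 1, 0, 0] * (Y : Matrix (Fin 3) (Fin 3) K)) := by
      rw [Matrix.map_add _ (map_add σ), Matrix.transpose_add, Matrix.add_mul, Matrix.mul_add]; abel
    rw [e, hz, hY, add_zero]
  let Φz : ↥𝔲 ≃ₜ+ F' × ↥𝔲₀ :=
    { toFun := fun X => (g (⅟(3 : K) * Matrix.trace (X : Matrix (Fin 3) (Fin 3) K) * ((lam⁻¹ : Kˣ) : K)),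
        ⟨(X : Matrix (Fin 3) (Fin 3) K) - (⅟(3 : K) * Matrix.trace (X : Matrix (Fin 3) (Fin 3) K)) • (1 : Matrix (Fin 3) (Fin 3) K), hfwd_mem X⟩)
      invFun := fun p => ⟨(lam * ι p.1) • (1 : Matrix (Fin 3) (Fin 3) K) + (p.2 : Matrix (Fin 3) (Fin 3) K), hbwd_mem p.1 p.2⟩
      left_inv := fun X => by
        apply Subtype.ext
        change (lam * ι (g (⅟(3 : K) * Matrix.trace (X : Matrix (Fin 3) (Fin 3) K) * ((lam⁻¹ : Kˣ) : K)))) • (1 : Matrix (Fin 3) (Fin 3) K) +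
          ((X : Matrix (Fin 3) (Fin 3) K) - (⅟(3 : K) * Matrix.trace (X : Matrix (Fin 3) (Fin 3) K)) • (1 : Matrix (Fin 3) (Fin 3) K)) = X
        rw [hzfix _ ((h𝔲 _).1 X.2), skew_recombine]
        abel
      right_inv := fun p => by
        obtain ⟨b, Y⟩ := p
        have hY := ((h𝔲₀ _).1 Y.2).2
        have htr : Matrix.trace ((lam * ι b) • (1 : Matrix (Fin 3) (Fin 3) K) + (Y : Matrix (Fin 3) (Fin 3) K)) = 3 * (lam * ι b) := by
          rw [Matrix.trace_add, Matrix.trace_smul, Matrix.trace_one, hY, smul_eq_mul]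
          simp only [Fintype.card_fin, Nat.cast_ofNat, add_zero]
          ring
        have hz : ⅟(3 : K) * Matrix.trace ((lam * ι b) • (1 : Matrix (Fin 3) (Fin 3) K) + (Y : Matrix (Fin 3) (Fin 3) K)) = lam * ι b := by
          rw [htr, ← mul_assoc, invOf_mul_self, one_mul]
        refine Prod.ext ?_ (Subtype.ext ?_)
        · change g (⅟(3 : K) * Matrix.trace ((lam * ι b) • (1 : Matrix (Fin 3) (Fin 3) K) + (Y : Matrix (Fin 3) (Fin 3) K)) * ((lam⁻¹ : Kˣ) : K)) = b
          rw [hz, mul_comm (lam : K) (ι b), Units.mul_inv_cancel_right, hg]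
        · change (lam * ι b) • (1 : Matrix (Fin 3) (Fin 3) K) + (Y : Matrix (Fin 3) (Fin 3) K) -
            (⅟(3 : K) * Matrix.trace ((lam * ι b) • (1 : Matrix (Fin 3) (Fin 3) K) + (Y : Matrix (Fin 3) (Fin 3) K))) • (1 : Matrix (Fin 3) (Fin 3) K) = Y
          rw [hz]; abel
      map_add' := fun X X' => by
        refine Prod.ext ?_ (Subtype.ext ?_)
        · change g (⅟(3 : K) * Matrix.trace ((X : Matrix (Fin 3) (Fin 3) K) + (X' : Matrix (Fin 3) (Fin 3) K)) * ((lam⁻¹ : Kˣ) : K)) =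
            g (⅟(3 : K) * Matrix.trace (X : Matrix (Fin 3) (Fin 3) K) * ((lam⁻¹ : Kˣ) : K)) + g (⅟(3 : K) * Matrix.trace (X' : Matrix (Fin 3) (Fin 3) K) * ((lam⁻¹ : Kˣ) : K))
          apply hι.injective
          rw [map_add, hzfix _ ((h𝔲 _).1 X.2), hzfix _ ((h𝔲 _).1 X'.2), hzfix _ ((h𝔲 _).1 (𝔲.add_mem X.2 X'.2)), Matrix.trace_add]
          ring
        · change (X : Matrix (Fin 3) (Fin 3) K) + (X' : Matrix (Fin 3) (Fin 3) K) - (⅟(3 : K) * Matrix.trace ((X : Matrix (Fin 3) (Fin 3) K) + (X' : Matrix (Fin 3) (Fin 3) K))) • (1 : Matrix (Fin 3) (Fin 3) K) =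
            ((X : Matrix (Fin 3) (Fin 3) K) - (⅟(3 : K) * Matrix.trace (X : Matrix (Fin 3) (Fin 3) K)) • (1 : Matrix (Fin 3) (Fin 3) K)) +
            ((X' : Matrix (Fin 3) (Fin 3) K) - (⅟(3 : K) * Matrix.trace (X' : Matrix (Fin 3) (Fin 3) K)) • (1 : Matrix (Fin 3) (Fin 3) K))
          rw [Matrix.trace_add, mul_add, add_smul]
          abel
      continuous_toFun := by
        refine Continuous.prodMk ?_ ?_
        · have htrc : Continuous fun X : ↥𝔲 => ⅟(3 : K) * Matrix.trace (X : Matrix (Fin 3) (Fin 3) K) * ((lam⁻¹ : Kˣ) : K) :=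
            ((continuous_const.mul continuous_subtype_val.matrix_trace).mul continuous_const)
          exact hgc.comp_continuous htrc fun X => (hιr _).1 (by
            have hX := (h𝔲 _).1 X.2
            have hsk : σ (⅟(3 : K) * Matrix.trace (X : Matrix (Fin 3) (Fin 3) K)) + ⅟(3 : K) * Matrix.trace (X : Matrix (Fin 3) (Fin 3) K) = 0 := by
              rw [map_mul, hσ3]; linear_combination (⅟(3 : K)) * htrace_skew _ hX
            exact skew_fixed σ lam hlam hsk)
        · exact ((continuous_subtype_val.sub ((continuous_const.mul continuous_subtype_val.matrix_trace).smul
            continuous_const))).subtype_mk _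
      continuous_invFun := by
        exact (((continuous_const.mul (hιc.comp continuous_fst)).smul continuous_const).add
          (continuous_subtype_val.comp continuous_snd)).subtype_mk _ }
  refine ⟨Φz, fun b Y => rfl, fun X => ⟨?_, ?_⟩⟩
  · change lam * ι (g (⅟(3 : K) * Matrix.trace (X : Matrix (Fin 3) (Fin 3) K) * ((lam⁻¹ : Kˣ) : K))) = _
    rw [hzfix _ ((h𝔲 _).1 X.2), skew_recombine]
  · change (X : Matrix (Fin 3) (Fin 3) K) - (⅟(3 : K) * Matrix.trace (X : Matrix (Fin 3) (Fin 3) K)) • (1 : Matrix (Fin 3) (Fin 3) K) =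
      (X : Matrix (Fin 3) (Fin 3) K) - (lam * ι (g (⅟(3 : K) * Matrix.trace (X : Matrix (Fin 3) (Fin 3) K) * ((lam⁻¹ : Kˣ) : K)))) • (1 : Matrix (Fin 3) (Fin 3) K)
    rw [hzfix _ ((h𝔲 _).1 X.2), skew_recombine]


end Charts

/-! ## §4 Transport of Haar measure along the charts -/

section Haar

variable {K : Type*} [Field K] [TopologicalSpace K] [IsTopologicalRing K]
  {F' : Type*} [Field F'] [TopologicalSpace F'] [IsTopologicalRing F']

/-- **The image of ANY additive Haar measure under a coordinate chart `Φ₀ : (Fin n → F′) ≃ₜ+ ↥𝔲₀` is an additive Haar measure on `↥𝔲₀`** (Mathlib instance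
`ContinuousAddEquiv.isAddHaarMeasure_map`, made explicit for docking; applies to `Measure.pi` of a Haar measure on `F′`). [cite: PlatonovRapinchuk1994, §3.3] -/
theorem isAddHaarMeasure_map_coords {n : ℕ} (𝔲₀ : AddSubgroup (Matrix (Fin 3) (Fin 3) K)) (Φ₀ : (Fin n → F') ≃ₜ+ ↥𝔲₀)
    [MeasurableSpace (Fin n → F')] [BorelSpace (Fin n → F')] [MeasurableSpace ↥𝔲₀] [BorelSpace ↥𝔲₀]
    (ν : Measure (Fin n → F')) [ν.IsAddHaarMeasure] : (ν.map Φ₀).IsAddHaarMeasure :=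
  inferInstance

/-- **`ν.map Φ₀ = c • μ` with `0 < c`** for additive Haar measures `ν` on `Fin n → F′` and `μ` on `↥𝔲₀`, when `F′` is locally compact and second countable (e.g. a
non-archimedean local field): uniqueness of Haar measure on the (locally compact, second countable — transported along `Φ₀`) group `↥𝔲₀`.
[cite: PlatonovRapinchuk1994, §3.3] -/
theorem exists_map_coords_eq_smul [LocallyCompactSpace F'] [SecondCountableTopology F'] {n : ℕ}
    (𝔲₀ : AddSubgroup (Matrix (Fin 3) (Fin 3) K)) (Φ₀ : (Fin n → F') ≃ₜ+ ↥𝔲₀)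
    [MeasurableSpace (Fin n → F')] [BorelSpace (Fin n → F')] [MeasurableSpace ↥𝔲₀] [BorelSpace ↥𝔲₀]
    (ν : Measure (Fin n → F')) [ν.IsAddHaarMeasure] (μ : Measure ↥𝔲₀) [μ.IsAddHaarMeasure] :
    ∃ c : NNReal, 0 < c ∧ ν.map Φ₀ = c • μ := by
  haveI : LocallyCompactSpace ↥𝔲₀ := Φ₀.toHomeomorph.symm.locallyCompactSpace_iff.2 inferInstance
  haveI : SecondCountableTopology ↥𝔲₀ := Φ₀.toHomeomorph.symm.secondCountableTopology
  exact ⟨Measure.addHaarScalarFactor (ν.map Φ₀) μ, Measure.addHaarScalarFactor_pos_of_isAddHaarMeasure _ _,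
    Measure.isAddLeftInvariant_eq_smul (ν.map Φ₀) μ⟩

end Haar

end Summit.HodgeConjecture.HodgeConjecture.Cruxes.H413.F0P3cStCharTSHCDCoordinates
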